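import Literature.Analysis.Calculus.SardProofs
import Mathlib.Analysis.Calculus.InverseFunctionTheorem.ContDiff
import Mathlib.Analysis.Calculus.ContDiff.Operations
import Mathlib.Topology.Algebra.Module.FiniteDimension
import Mathlib.Analysis.Normed.Operator.BoundedLinearMaps
import Mathlib.MeasureTheory.Measure.Haar.OfBasis
import HarnessLib

/-!
# The parametric transversality theorem (Thom), Euclidean form, from Sard's theorem

Topic `Literature/Analysis/Calculus`.  Everything in this file is **proved**; no definitions, no
named facts.  This is the finite-dimensional engine behind Thom's transversality theorems as they
are used in Cerf theory (J. Cerf, *Sur les difféomorphismes de la sphère de dimension trois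
(Γ₄ = 0)*, LNM 53 (1968), Ch. II §1, "théorème de transversalité local / au but", applied in
Ch. II §2 to paths of functions) and written for that purpose (programme of the fact
`Literature.Topology.FourManifolds.cerf_pi0DiffDisc_relBoundary_three`).

**Theorem (parametric transversality; Hirsch, *Differential Topology* (1976), Ch. 3, Thm. 2.7;
Guillemin–Pollack (1974), Ch. 2 §3 "The Transversality Theorem").**  Let `P` (parameters), `X`
(source) and `F` (target) be finite-dimensional real normed spaces, `Ω ⊆ P × X` open, and
`G : P × X → F` of class `C^∞` on `Ω`.  Suppose that at every zero `z ∈ Ω` of `G` the PARTIAL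
derivative in the parameter, `∂₁G(z) = DG(z) ∘ inl : P → F`, is onto.  Then for almost every
parameter `p` (any additive Haar measure on `P`) the map `G(p, ·)` has `0` as a regular value on
`Ω_p`: at every `x` with `(p, x) ∈ Ω` and `G(p, x) = 0` the partial derivative
`∂₂G(p, x) = DG(p, x) ∘ inr : X → F` is onto
(`ae_surjective_fderiv_inr`, `measure_setOf_exists_zero_not_surjective_eq_zero`).  In particular,
when `dim X < dim F`, for almost every `p` the map `G(p, ·)` has no zero on `Ω_p` at all
(`ae_forall_ne_zero_of_finrank_lt`), and good parameters exist in every non-empty open set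
(`exists_mem_isOpen_of_ae`).

**Proof** (the printed one, Hirsch 3.2.7 / Guillemin–Pollack p. 68, with Sard's theorem taken from
the tree: `Literature.Analysis.Calculus.measure_image_setOf_not_surjective_fderiv_eq_zero`,
`SardProofs.lean`).  Near a zero `z₀` the total derivative `A = DG(z₀)` is onto, so with a
continuous projection `π` of `P × X` onto `ker A` the map `Φ(z) = (G z, π (z - z₀))` is a local
diffeomorphism at `z₀` (inverse function theorem, `ContDiffAt.toOpenPartialHomeomorph`); its
inverse restricted to `{0} × ker A` is a `C^∞` chart `ψ` of the zero set, and the bad parameters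
coming from zeros near `z₀` are critical values of `h = pr₁ ∘ ψ : ker A → P`: if `Dh(w)` is onto
then, differentiating `G ∘ ψ = 0`, every `∂₁G u` is a `-∂₂G v`, so `∂₂G` is onto.  Sard's
theorem makes these critical values null, and second countability of `P × X` globalises
(`Sard.measure_image_null_of_locally`).

## References

* M. W. Hirsch, *Differential Topology*, GTM 33 (1976), Ch. 3 §2, Thm. 2.7. [HirschDT1976]
* V. Guillemin, A. Pollack, *Differential topology* (1974; AMS Chelsea 2010), Ch. 2 §3, "The
  Transversality Theorem", p. 68. [GuilleminPollack2010]
* R. Thom, *Un lemme sur les applications différentiables*, Bol. Soc. Mat. Mexicana 1 (1956)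
  59–71.
* J. Cerf, *Sur les difféomorphismes de la sphère de dimension trois (Γ₄ = 0)*, LNM 53 (1968),
  Ch. II §1. [CerfDiffeoSphere1968]
* A. Sard, Bull. AMS 48 (1942) 883–890. [Sard1942]

## Design notes

All three spaces live in one universe (the tree's Sard theorem is stated that way).  Partial
derivatives are written `fderiv ℝ G z ∘L ContinuousLinearMap.inl ℝ P X` and `… ∘L .inr …`, which
agree with the derivatives of the sections `G(·, x)`, `G(p, ·)` wherever `G` is differentiable
(`hasFDerivAt_curry_left` / `_right` below).
-/

noncomputable section

open MeasureTheory Set Function Filter Module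
open scoped ContDiff Topology

namespace Literature.Analysis.Calculus

universe u

namespace ParametricTransversality

/-! ### Linear algebra: `(A, π)` is an isomorphism when `A` is onto and `π` projects onto `ker A` -/

section LinearAlgebra

variable {E : Type u} [NormedAddCommGroup E] [NormedSpace ℝ E] [FiniteDimensional ℝ E]
  {F : Type u} [NormedAddCommGroup F] [NormedSpace ℝ F] [FiniteDimensional ℝ F]

omit [FiniteDimensional ℝ E] [FiniteDimensional ℝ F] in
/-- If `A : E → F` is onto and `π` is a projection of `E` onto `ker A`, then `z ↦ (A z, π z)` is
injective. [folklore] -/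
theorem injective_prod_proj (A : E →L[ℝ] F) (π : E →L[ℝ] A.ker)
    (hπ : ∀ v : A.ker, π v = v) : Injective (A.prod π) := by
  rw [injective_iff_map_eq_zero]
  intro v hv
  rw [ContinuousLinearMap.prod_apply, Prod.mk_eq_zero] at hv
  have hker : v ∈ A.ker := hv.1
  have h := hπ ⟨v, hker⟩
  rw [hv.2] at h
  have h' := congrArg Subtype.val h
  simpa using h'.symm

/-- Rank–nullity: if `A : E → F` is onto then `dim E = dim (F × ker A)`. [folklore] -/
theorem finrank_eq_finrank_prod_ker (A : E →L[ℝ] F) (hA : A.range = ⊤) :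
    finrank ℝ E = finrank ℝ (F × A.ker) := by
  rw [Module.finrank_prod]
  have h := LinearMap.finrank_range_add_finrank_ker (A : E →ₗ[ℝ] F)
  have hr : finrank ℝ (LinearMap.range (A : E →ₗ[ℝ] F)) = finrank ℝ F := by
    have : LinearMap.range (A : E →ₗ[ℝ] F) = ⊤ := hA
    rw [this, finrank_top]
  rw [hr] at h
  exact h.symm

/-- If `A : E → F` is onto and `π` is a projection of `E` onto `ker A`, then `z ↦ (A z, π z)` is a
linear isomorphism `E ≃ F × ker A`. [folklore] -/
theorem bijective_prod_proj (A : E →L[ℝ] F) (hA : A.range = ⊤)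
    (π : E →L[ℝ] A.ker) (hπ : ∀ v : A.ker, π v = v) :
    Bijective (A.prod π) := by
  have hinj := injective_prod_proj A π hπ
  refine ⟨hinj, ?_⟩
  have hdim := finrank_eq_finrank_prod_ker A hA
  have key := (LinearMap.injective_iff_surjective_of_finrank_eq_finrank hdim
    (f := (A.prod π : E →ₗ[ℝ] F × A.ker))).1 hinj
  exact key

/-- A bijective continuous linear map between finite-dimensional spaces, as a continuous linear
equivalence with the same underlying function. [folklore] -/
theorem exists_equiv_of_bijective {E' : Type u} [NormedAddCommGroup E'] [NormedSpace ℝ E']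
    [FiniteDimensional ℝ E'] (D : E →L[ℝ] E') (hD : Bijective D) :
    ∃ D' : E ≃L[ℝ] E', (D' : E →L[ℝ] E') = D := by
  let L : E ≃ₗ[ℝ] E' := LinearEquiv.ofBijective (D : E →ₗ[ℝ] E') hD
  refine ⟨L.toContinuousLinearEquiv, ?_⟩
  ext v
  rfl

end LinearAlgebra

/-! ### Partial derivatives of a map on a product -/

section Partial

variable {P : Type u} [NormedAddCommGroup P] [NormedSpace ℝ P]
  {X : Type u} [NormedAddCommGroup X] [NormedSpace ℝ X]
  {F : Type u} [NormedAddCommGroup F] [NormedSpace ℝ F]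

/-- The section `p ↦ G (p, x)` has derivative `DG(p, x) ∘ inl`. [folklore] -/
theorem hasFDerivAt_curry_left {G : P × X → F} {z : P × X} {A : P × X →L[ℝ] F}
    (hG : HasFDerivAt G A z) :
    HasFDerivAt (fun p => G (p, z.2)) (A ∘L ContinuousLinearMap.inl ℝ P X) z.1 := by
  have h1 : HasFDerivAt (fun p : P => (p, z.2)) (ContinuousLinearMap.inl ℝ P X) z.1 :=
    (hasFDerivAt_id z.1).prodMk (hasFDerivAt_const z.2 z.1)
  have h2 : HasFDerivAt G A ((fun p : P => (p, z.2)) z.1) := by simpa using hG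
  exact h2.comp z.1 h1

/-- The section `x ↦ G (p, x)` has derivative `DG(p, x) ∘ inr`. [folklore] -/
theorem hasFDerivAt_curry_right {G : P × X → F} {z : P × X} {A : P × X →L[ℝ] F}
    (hG : HasFDerivAt G A z) :
    HasFDerivAt (fun x => G (z.1, x)) (A ∘L ContinuousLinearMap.inr ℝ P X) z.2 := by
  have h1 : HasFDerivAt (fun x : X => (z.1, x)) (ContinuousLinearMap.inr ℝ P X) z.2 :=
    (hasFDerivAt_const z.1 z.2).prodMk (hasFDerivAt_id z.2)
  have h2 : HasFDerivAt G A ((fun x : X => (z.1, x)) z.2) := by simpa using hG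
  exact h2.comp z.2 h1

/-- `DG(z) (u, v) = ∂₁G(z) u + ∂₂G(z) v`. [folklore] -/
theorem apply_eq_inl_add_inr (A : P × X →L[ℝ] F) (u : P) (v : X) :
    A (u, v) = (A ∘L ContinuousLinearMap.inl ℝ P X) u + (A ∘L ContinuousLinearMap.inr ℝ P X) v := by
  rw [ContinuousLinearMap.comp_apply, ContinuousLinearMap.comp_apply,
    ContinuousLinearMap.inl_apply, ContinuousLinearMap.inr_apply, ← map_add]
  simp

/-- **The linear-algebra heart of parametric transversality.**  If `A ∘ T = 0` for a linear map
`T : K → P × X` whose first component `pr₁ ∘ T` is onto `P`, and `∂₁ = A ∘ inl` is onto `F`, then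
`∂₂ = A ∘ inr` is onto `F` (every `∂₁ u` is a `-∂₂ v`).  Hirsch (1976), proof of Thm. 3.2.7.
[cite: HirschDT1976, Ch. 3 §2, proof of Thm. 2.7] -/
theorem surjective_inr_of_comp_eq_zero {K : Type*} [NormedAddCommGroup K] [NormedSpace ℝ K]
    (A : P × X →L[ℝ] F) (T : K →L[ℝ] P × X) (hAT : A ∘L T = 0)
    (hfst : Surjective (ContinuousLinearMap.fst ℝ P X ∘L T))
    (h₁ : Surjective (A ∘L ContinuousLinearMap.inl ℝ P X)) :
    Surjective (A ∘L ContinuousLinearMap.inr ℝ P X) := by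
  intro f
  obtain ⟨u, hu⟩ := h₁ f
  obtain ⟨k, hk⟩ := hfst u
  have hk' : (T k).1 = u := by simpa using hk
  have h0 : A (T k) = 0 := by
    have := congrArg (fun L : K →L[ℝ] F => L k) hAT
    simpa using this
  have hsplit := apply_eq_inl_add_inr A (T k).1 (T k).2
  rw [Prod.mk.eta, h0, hk', hu] at hsplit
  refine ⟨-(T k).2, ?_⟩
  rw [map_neg]
  have : (A ∘L ContinuousLinearMap.inr ℝ P X) (T k).2 = -f := by
    have h := hsplit.symm
    -- `f + ∂₂ v = 0`
    exact eq_neg_of_add_eq_zero_right h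
  rw [this, neg_neg]

end Partial

/-! ### The local statement: near a zero, bad parameters are critical values of a chart map -/

section Local

variable {P : Type u} [NormedAddCommGroup P] [NormedSpace ℝ P] [FiniteDimensional ℝ P]
  {X : Type u} [NormedAddCommGroup X] [NormedSpace ℝ X] [FiniteDimensional ℝ X]
  {F : Type u} [NormedAddCommGroup F] [NormedSpace ℝ F] [FiniteDimensional ℝ F]
  [MeasurableSpace P] [BorelSpace P]

omit [FiniteDimensional ℝ P] [FiniteDimensional ℝ X] [FiniteDimensional ℝ F] [MeasurableSpace P]
  [BorelSpace P] in
/-- The set of "bad" points: zeros of `G` in `Ω` at which `∂₂G` is not onto. [folklore] -/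
theorem mem_badSet_iff (G : P × X → F) (Ω : Set (P × X)) (z : P × X) :
    z ∈ {z ∈ Ω | G z = 0 ∧ ¬ Surjective (fderiv ℝ G z ∘L ContinuousLinearMap.inr ℝ P X)} ↔
      z ∈ Ω ∧ G z = 0 ∧ ¬ Surjective (fderiv ℝ G z ∘L ContinuousLinearMap.inr ℝ P X) :=
  Iff.rfl

/-- **Local parametric transversality** (Hirsch 1976, proof of Thm. 3.2.7; Guillemin–Pollack
1974, p. 68).  Let `G` be `C^∞` on the open set `Ω ⊆ P × X` with `∂₁G` onto at every zero of `G`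
in `Ω`, and let `z₀ ∈ Ω` be a zero.  Then `z₀` has a neighbourhood `V` such that the parameters
`p` of the bad zeros `(p, x) ∈ V` (those with `∂₂G(p, x)` not onto) form a `μ`-null set: they are
critical values of the first projection restricted to a `C^∞` chart of the zero set (inverse
function theorem), hence null by Sard's theorem.
[cite: HirschDT1976, Ch. 3 §2, Thm. 2.7] [cite: GuilleminPollack2010, Ch. 2 §3, p. 68] -/
theorem exists_nhds_measure_image_fst_eq_zero (μ : Measure P) [μ.IsAddHaarMeasure]
    {G : P × X → F} {Ω : Set (P × X)} (hΩ : IsOpen Ω) (hG : ContDiffOn ℝ ∞ G Ω)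
    (h₁ : ∀ z ∈ Ω, G z = 0 → Surjective (fderiv ℝ G z ∘L ContinuousLinearMap.inl ℝ P X))
    {z₀ : P × X} (hz₀ : z₀ ∈ Ω) (hG₀ : G z₀ = 0) :
    ∃ V ∈ 𝓝 z₀, μ (Prod.fst ''
      ({z ∈ Ω | G z = 0 ∧ ¬ Surjective (fderiv ℝ G z ∘L ContinuousLinearMap.inr ℝ P X)} ∩ V)) = 0 := by
  classical
  haveI : CompleteSpace (P × X) := FiniteDimensional.complete ℝ (P × X)
  -- the total derivative at `z₀` is onto
  set A : P × X →L[ℝ] F := fderiv ℝ G z₀ with hA_def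
  have hAonto : Surjective A := by
    intro f
    obtain ⟨u, hu⟩ := h₁ z₀ hz₀ hG₀ f
    exact ⟨ContinuousLinearMap.inl ℝ P X u, by simpa using hu⟩
  have hArange : A.range = ⊤ :=
    LinearMap.range_eq_top.2 fun f => by obtain ⟨u, hu⟩ := hAonto f; exact ⟨u, hu⟩
  -- a continuous projection onto `K = ker A`
  haveI : FiniteDimensional ℝ A.range := inferInstance
  set K : Submodule ℝ (P × X) := A.ker with hK_def
  obtain ⟨π, hπ⟩ : K.ClosedComplemented :=
    A.ker_closedComplemented_of_finiteDimensional_range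
  -- the chart map `Φ z = (G z, π (z - z₀))` and its derivative `D z = (DG z, π)`
  set Φ : P × X → F × K := fun z => (G z, π (z - z₀)) with hΦ_def
  set D : P × X → (P × X →L[ℝ] F × K) := fun z => (fderiv ℝ G z).prod π with hD_def
  have hGdiff : ∀ z ∈ Ω, HasFDerivAt G (fderiv ℝ G z) z := fun z hz =>
    ((hG.contDiffAt (hΩ.mem_nhds hz)).differentiableAt (by simp)).hasFDerivAt
  have hπdiff : ∀ z, HasFDerivAt (fun z : P × X => π (z - z₀)) π z := fun z => by
    have h := π.hasFDerivAt.comp z ((hasFDerivAt_id z).sub_const z₀)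
    rw [ContinuousLinearMap.comp_id] at h
    exact h
  have hΦderiv : ∀ z ∈ Ω, HasFDerivAt Φ (D z) z := fun z hz =>
    (hGdiff z hz).prodMk (hπdiff z)
  have hΦsmooth : ∀ z ∈ Ω, ContDiffAt ℝ ∞ Φ z := fun z hz =>
    (hG.contDiffAt (hΩ.mem_nhds hz)).prodMk
      ((π.contDiff.comp (contDiff_id.sub contDiff_const)).contDiffAt)
  -- `D z₀` is invertible
  have hDbij : Bijective (D z₀) := bijective_prod_proj A hArange π hπ
  obtain ⟨D₀, hD₀⟩ := exists_equiv_of_bijective (D z₀) hDbij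
  have hΦderiv₀ : HasFDerivAt Φ (D₀ : P × X →L[ℝ] F × K) z₀ := by
    rw [hD₀]; exact hΦderiv z₀ hz₀
  -- the inverse function theorem at `z₀`
  set e := (hΦsmooth z₀ hz₀).toOpenPartialHomeomorph Φ hΦderiv₀ (by simp) with he_def
  have he_coe : (e : P × X → F × K) = Φ := (hΦsmooth z₀ hz₀).toOpenPartialHomeomorph_coe hΦderiv₀ _
  have hz₀source : z₀ ∈ e.source :=
    (hΦsmooth z₀ hz₀).mem_toOpenPartialHomeomorph_source hΦderiv₀ _
  -- `D` is continuous on `Ω`, and invertibility is open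
  have hDcont : ContinuousOn D Ω := by
    have hc : ContinuousOn (fun z => fderiv ℝ G z) Ω :=
      hG.continuousOn_fderiv_of_isOpen hΩ (by simp)
    have hlin : Continuous fun L : P × X →L[ℝ] F => L.prod π := by
      have : (fun L : P × X →L[ℝ] F => L.prod π) =
          fun L => (ContinuousLinearMap.inl ℝ F K) ∘L L + (ContinuousLinearMap.inr ℝ F K) ∘L π := by
        funext L; ext v <;> simp
      rw [this]
      exact ((ContinuousLinearMap.compL ℝ (P × X) F (F × K)
        (ContinuousLinearMap.inl ℝ F K)).continuous).add continuous_const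
    exact hlin.comp_continuousOn hc
  set Inv : Set ((P × X) →L[ℝ] (F × K)) :=
    range ((↑) : ((P × X) ≃L[ℝ] (F × K)) → (P × X) →L[ℝ] (F × K)) with hInv_def
  have hInvOpen : IsOpen Inv := ContinuousLinearEquiv.isOpen
  -- the good neighbourhood
  set V : Set (P × X) := (Ω ∩ D ⁻¹' Inv) ∩ e.source with hV_def
  have hVopen : IsOpen V := (hDcont.isOpen_inter_preimage hΩ hInvOpen).inter e.open_source
  have hz₀V : z₀ ∈ V := ⟨⟨hz₀, ⟨D₀, hD₀⟩⟩, hz₀source⟩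
  have hVΩ : V ⊆ Ω := fun z hz => hz.1.1
  have hVsource : V ⊆ e.source := fun z hz => hz.2
  refine ⟨V, hVopen.mem_nhds hz₀V, ?_⟩
  -- the chart of the zero set: `ψ w = e⁻¹ (0, w)` on `W = {w | (0, w) ∈ e '' V}`
  set ι : K → F × K := fun w => ((0 : F), w) with hι_def
  have hιcont : Continuous ι := continuous_const.prodMk continuous_id
  have hιdiff : ContDiff ℝ ∞ ι := contDiff_const.prodMk contDiff_id
  have heV : IsOpen (e '' V) := e.isOpen_image_of_subset_source hVopen hVsource
  set W : Set K := ι ⁻¹' (e '' V) with hW_def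
  have hWopen : IsOpen W := heV.preimage hιcont
  set ψ : K → P × X := fun w => e.symm (ι w) with hψ_def
  set h : K → P := fun w => (ψ w).1 with hh_def
  -- smoothness of `e.symm` at the points `(0, w)`, `w ∈ W`
  have hsymm_smooth : ∀ w ∈ W, ContDiffAt ℝ ∞ e.symm (ι w) ∧ e.symm (ι w) ∈ V := by
    intro w hw
    obtain ⟨z, hzV, hz⟩ := hw
    have hzs : z ∈ e.source := hVsource hzV
    have hsymm : e.symm (ι w) = z := by rw [← hz]; exact e.left_inv hzs
    have htarget : ι w ∈ e.target := by rw [← hz]; exact e.map_source hzs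
    obtain ⟨Dz, hDz⟩ := hzV.1.2
    have hderiv : HasFDerivAt e (Dz : P × X →L[ℝ] F × K) (e.symm (ι w)) := by
      rw [hsymm, he_coe, hDz]; exact hΦderiv z (hVΩ hzV)
    have hsm : ContDiffAt ℝ ∞ e (e.symm (ι w)) := by
      rw [hsymm, he_coe]; exact hΦsmooth z (hVΩ hzV)
    exact ⟨e.contDiffAt_symm htarget hderiv hsm, hsymm ▸ hzV⟩
  have hψsmooth : ∀ w ∈ W, ContDiffAt ℝ ∞ ψ w := fun w hw =>
    (hsymm_smooth w hw).1.comp w hιdiff.contDiffAt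
  have hhsmooth : ContDiffOn ℝ ∞ h W := fun w hw =>
    (contDiffAt_fst.comp w (hψsmooth w hw)).contDiffWithinAt
  -- Sard for `h : K → P`
  have hSard := measure_image_setOf_not_surjective_fderiv_eq_zero μ hWopen hhsmooth
  refine measure_mono_null ?_ hSard
  -- every bad zero in `V` is `h` of a critical point of `h`
  rintro p ⟨z, ⟨⟨hzΩ, hGz, hbad⟩, hzV⟩, rfl⟩
  set w : K := π (z - z₀) with hw_def
  have hez : e z = ι w := by
    rw [he_coe]
    simp [hΦ_def, hι_def, hGz, hw_def]
  have hwW : w ∈ W := ⟨z, hzV, hez⟩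
  have hψw : ψ w = z := by
    simp only [hψ_def]; rw [← hez]; exact e.left_inv (hVsource hzV)
  refine ⟨w, ⟨hwW, ?_⟩, by simp [hh_def, hψw]⟩
  -- if `Dh(w)` were onto, `∂₂G(z)` would be onto
  intro hsurj
  apply hbad
  have hψdiff : HasFDerivAt ψ (fderiv ℝ ψ w) w :=
    ((hψsmooth w hwW).differentiableAt (by simp)).hasFDerivAt
  -- `G ∘ ψ = 0` near `w`
  have hGψ : (fun w' => G (ψ w')) =ᶠ[𝓝 w] fun _ => (0 : F) := by
    have htarget_nhds : ∀ᶠ w' in 𝓝 w, ι w' ∈ e.target := by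
      have : ι w ∈ e.target := by rw [← hez]; exact e.map_source (hVsource hzV)
      exact hιcont.continuousAt.preimage_mem_nhds (e.open_target.mem_nhds this)
    filter_upwards [htarget_nhds] with w' hw'
    have h1 : e (e.symm (ι w')) = ι w' := e.right_inv hw'
    have h2 : (e (e.symm (ι w'))).1 = G (e.symm (ι w')) := by rw [he_coe]
    rw [hψ_def]
    rw [← h2, h1]
  have hderiv_comp : HasFDerivAt (fun w' => G (ψ w')) (fderiv ℝ G z ∘L fderiv ℝ ψ w) w := by
    have hGz' : HasFDerivAt G (fderiv ℝ G z) (ψ w) := by rw [hψw]; exact hGdiff z hzΩ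
    exact hGz'.comp w hψdiff
  have hzero : fderiv ℝ G z ∘L fderiv ℝ ψ w = 0 := by
    have h1 := hderiv_comp.fderiv
    have h2 : fderiv ℝ (fun w' => G (ψ w')) w = 0 := by
      rw [hGψ.fderiv_eq]; exact fderiv_const_apply (0 : F)
    rw [← h1, h2]
  have hfst : fderiv ℝ h w = ContinuousLinearMap.fst ℝ P X ∘L fderiv ℝ ψ w := by
    have : HasFDerivAt h (ContinuousLinearMap.fst ℝ P X ∘L fderiv ℝ ψ w) w :=
      (ContinuousLinearMap.fst ℝ P X).hasFDerivAt.comp w hψdiff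
    exact this.fderiv
  rw [hfst] at hsurj
  exact surjective_inr_of_comp_eq_zero (fderiv ℝ G z) (fderiv ℝ ψ w) hzero hsurj (h₁ z hzΩ hGz)

end Local

/-! ### The global statements -/

section Global

variable {P : Type u} [NormedAddCommGroup P] [NormedSpace ℝ P] [FiniteDimensional ℝ P]
  {X : Type u} [NormedAddCommGroup X] [NormedSpace ℝ X] [FiniteDimensional ℝ X]
  {F : Type u} [NormedAddCommGroup F] [NormedSpace ℝ F] [FiniteDimensional ℝ F]
  [MeasurableSpace P] [BorelSpace P]

/-- **Parametric transversality theorem, measure form** (Thom 1956; Hirsch 1976, Ch. 3,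
Thm. 2.7; Guillemin–Pollack 1974, Ch. 2 §3; the finite-dimensional content of Cerf's use of
Thom's theorems, LNM 53 (1968), Ch. II §1).  Let `G : P × X → F` be `C^∞` on the open set `Ω`,
with `∂₁G(z)` onto at every zero `z ∈ Ω` of `G`.  Then the set of parameters `p` for which some
zero `(p, x) ∈ Ω` of `G` has `∂₂G(p, x)` NOT onto is null for every additive Haar measure on `P`.
[cite: HirschDT1976, Ch. 3 §2, Thm. 2.7] [cite: GuilleminPollack2010, Ch. 2 §3, p. 68]
[cite: CerfDiffeoSphere1968, Ch. II §1] -/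
theorem measure_setOf_exists_zero_not_surjective_eq_zero (μ : Measure P) [μ.IsAddHaarMeasure]
    {G : P × X → F} {Ω : Set (P × X)} (hΩ : IsOpen Ω) (hG : ContDiffOn ℝ ∞ G Ω)
    (h₁ : ∀ z ∈ Ω, G z = 0 → Surjective (fderiv ℝ G z ∘L ContinuousLinearMap.inl ℝ P X)) :
    μ {p | ∃ x, (p, x) ∈ Ω ∧ G (p, x) = 0 ∧
      ¬ Surjective (fderiv ℝ G (p, x) ∘L ContinuousLinearMap.inr ℝ P X)} = 0 := by
  set S : Set (P × X) :=
    {z ∈ Ω | G z = 0 ∧ ¬ Surjective (fderiv ℝ G z ∘L ContinuousLinearMap.inr ℝ P X)} with hS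
  have hset : {p | ∃ x, (p, x) ∈ Ω ∧ G (p, x) = 0 ∧
      ¬ Surjective (fderiv ℝ G (p, x) ∘L ContinuousLinearMap.inr ℝ P X)} = Prod.fst '' S := by
    ext p
    simp only [mem_setOf_eq, mem_image, hS, Prod.exists, exists_and_right, exists_eq_right]
  rw [hset]
  refine Sard.measure_image_null_of_locally μ Prod.fst S fun z hz => ?_
  exact exists_nhds_measure_image_fst_eq_zero μ hΩ hG h₁ hz.1 hz.2.1

/-- **Parametric transversality theorem, almost-everywhere form**: for almost every parameter `p`,
`0` is a regular value of `G(p, ·)` on `Ω_p` — `∂₂G(p, x)` is onto at every zero `(p, x) ∈ Ω`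
(Hirsch 1976, Ch. 3, Thm. 2.7; Guillemin–Pollack 1974, Ch. 2 §3).
[cite: HirschDT1976, Ch. 3 §2, Thm. 2.7] [cite: GuilleminPollack2010, Ch. 2 §3, p. 68] -/
theorem ae_surjective_fderiv_inr (μ : Measure P) [μ.IsAddHaarMeasure]
    {G : P × X → F} {Ω : Set (P × X)} (hΩ : IsOpen Ω) (hG : ContDiffOn ℝ ∞ G Ω)
    (h₁ : ∀ z ∈ Ω, G z = 0 → Surjective (fderiv ℝ G z ∘L ContinuousLinearMap.inl ℝ P X)) :
    ∀ᵐ p ∂μ, ∀ x, (p, x) ∈ Ω → G (p, x) = 0 →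
      Surjective (fderiv ℝ G (p, x) ∘L ContinuousLinearMap.inr ℝ P X) := by
  rw [ae_iff]
  refine measure_mono_null ?_ (measure_setOf_exists_zero_not_surjective_eq_zero μ hΩ hG h₁)
  intro p hp
  simp only [mem_setOf_eq, not_forall, exists_prop] at hp
  obtain ⟨x, hx, h0, hns⟩ := hp
  exact ⟨x, hx, h0, hns⟩

/-- The almost-everywhere form read through the sections: for almost every `p`, at every zero
`x` of `G(p, ·)` with `(p, x) ∈ Ω` the derivative `fderiv ℝ (fun x => G (p, x)) x` is onto.
[cite: HirschDT1976, Ch. 3 §2, Thm. 2.7] -/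
theorem ae_surjective_fderiv_section (μ : Measure P) [μ.IsAddHaarMeasure]
    {G : P × X → F} {Ω : Set (P × X)} (hΩ : IsOpen Ω) (hG : ContDiffOn ℝ ∞ G Ω)
    (h₁ : ∀ z ∈ Ω, G z = 0 → Surjective (fderiv ℝ G z ∘L ContinuousLinearMap.inl ℝ P X)) :
    ∀ᵐ p ∂μ, ∀ x, (p, x) ∈ Ω → G (p, x) = 0 →
      Surjective (fderiv ℝ (fun x => G (p, x)) x) := by
  filter_upwards [ae_surjective_fderiv_inr μ hΩ hG h₁] with p hp x hx h0
  have hd : HasFDerivAt G (fderiv ℝ G (p, x)) (p, x) :=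
    ((hG.contDiffAt (hΩ.mem_nhds hx)).differentiableAt (by simp)).hasFDerivAt
  rw [(hasFDerivAt_curry_right hd).fderiv]
  exact hp x hx h0

/-- **Parametric transversality below the dimension of the target**: if `dim X < dim F` then (no
linear map `X → F` being onto) for almost every parameter `p` the map `G(p, ·)` has NO zero on
`Ω_p` (Hirsch 1976, Ch. 3, Thm. 2.7 with the remark after Thm. 2.1; this is how all the
"condition d'intersection vide" clauses of Cerf, LNM 53, Ch. II §2 are obtained).
[cite: HirschDT1976, Ch. 3 §2, Thm. 2.7] [cite: CerfDiffeoSphere1968, Ch. II §2, Description de C₂–C₅] -/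
theorem ae_forall_ne_zero_of_finrank_lt (μ : Measure P) [μ.IsAddHaarMeasure]
    {G : P × X → F} {Ω : Set (P × X)} (hΩ : IsOpen Ω) (hG : ContDiffOn ℝ ∞ G Ω)
    (h₁ : ∀ z ∈ Ω, G z = 0 → Surjective (fderiv ℝ G z ∘L ContinuousLinearMap.inl ℝ P X))
    (hdim : finrank ℝ X < finrank ℝ F) :
    ∀ᵐ p ∂μ, ∀ x, (p, x) ∈ Ω → G (p, x) ≠ 0 := by
  filter_upwards [ae_surjective_fderiv_inr μ hΩ hG h₁] with p hp x hx h0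
  have hs := hp x hx h0
  have hle : finrank ℝ F ≤ finrank ℝ X := by
    have := LinearMap.finrank_range_le
      ((fderiv ℝ G (p, x) ∘L ContinuousLinearMap.inr ℝ P X : X →L[ℝ] F) : X →ₗ[ℝ] F)
    have hr : LinearMap.range
        ((fderiv ℝ G (p, x) ∘L ContinuousLinearMap.inr ℝ P X : X →L[ℝ] F) : X →ₗ[ℝ] F) = ⊤ :=
      LinearMap.range_eq_top.2 fun f => by obtain ⟨u, hu⟩ := hs f; exact ⟨u, hu⟩
    rw [hr, finrank_top] at this
    exact this
  exact absurd hdim (not_lt.2 hle)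

omit [NormedSpace ℝ P] [FiniteDimensional ℝ P] [BorelSpace P] in
/-- **Good parameters exist in every non-empty open set** (and in particular arbitrarily close to
`0`): an almost-everywhere property for an additive Haar measure holds somewhere in any non-empty
open set, open sets having positive Haar measure (Milnor 1965, §3, A. B. Brown's corollary
pattern). [cite: MilnorTDV1965, §3, Corollary p. 17] -/
theorem exists_mem_isOpen_of_ae (μ : Measure P) [μ.IsAddHaarMeasure] {Q : P → Prop}
    (hQ : ∀ᵐ p ∂μ, Q p) {U : Set P} (hU : IsOpen U) (hne : U.Nonempty) : ∃ p ∈ U, Q p := by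
  by_contra hcon
  have hsub : U ⊆ {p | ¬ Q p} := fun p hp hQp => hcon ⟨p, hp, hQp⟩
  have hnull : μ {p | ¬ Q p} = 0 := ae_iff.1 hQ
  have hUnull : μ U = 0 := measure_mono_null hsub hnull
  exact (hU.measure_pos μ hne).ne' hUnull

omit [NormedSpace ℝ P] [FiniteDimensional ℝ P] [BorelSpace P] in
/-- Good parameters of norm `< ε` exist, for every `ε > 0`. [cite: MilnorTDV1965, §3, Corollary p. 17] -/
theorem exists_norm_lt_of_ae (μ : Measure P) [μ.IsAddHaarMeasure] {Q : P → Prop}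
    (hQ : ∀ᵐ p ∂μ, Q p) {ε : ℝ} (hε : 0 < ε) : ∃ p : P, ‖p‖ < ε ∧ Q p := by
  obtain ⟨p, hp, hQp⟩ := exists_mem_isOpen_of_ae μ hQ Metric.isOpen_ball
    ⟨0, Metric.mem_ball_self hε⟩
  exact ⟨p, by simpa using hp, hQp⟩

end Global

end ParametricTransversality

end Literature.Analysis.Calculus
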